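import Summits.Ventures.HSemireg.HomComplexTwistTrace
import Summits.Ventures.HSemireg.CocycleExtensionPostcomp
import Summits.Ventures.HSemireg.DerivedDescentComp
import Summits.Ventures.HSemireg.AtiyahNuCommute
import Summits.Ventures.HSemireg.ShiftedHomMapComp
import Summits.Ventures.HSemireg.HomComplexSigmaSingle
import Summits.Ventures.HSemireg.DerivedDescentNatTrans
import HarnessLib

/-!
# Venture HSemireg — route R1.0, complex carriers: the traced shifted Homs `Tr′_q`, their LINEARITY over
# `ν = 1 ⊗ [dlog c]` and their INVARIANCE under `- ⊗ M` (gs-g4 gen 22, bricks C7c (ii) / C7d of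
# `general-structure/COMPLEX-LEIBNIZ-PLAN-gs-g4.md`)

HONEST FRAMING. Homological algebra on the tree's REAL carriers in `D(Mod 𝒪_X)`: t-7's `HomComplex.sigmaC`
pipeline (`unitQ`, `shiftedHomMap (homFunctor X K)`, `supertraceH`), th-4's cocycle twist, the bricks of this lineage.
Nothing about any variety; nothing here says HC, HC_CM or HC_AV is proved.

## Statements (everything proved; `namespace Summit.Ventures.HSemireg.HomComplex`)

* `traceShiftedHom X K a b hK q : ShiftedHom (Q K) (Q (K ⊗ Ω^q)) (q + 2) →+ ShiftedHom (Q 𝒪[0]) (Q Ω^q[0]) (q + 2)`,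
  `z ↦ [Q unit] · Φ_K(z) · [Q Tr•_q]` — so that `sigmaC X K a b hK q x = traceShiftedHom … (extMulAtiyahPower X K q x)`
  (`sigmaC_eq_traceShiftedHom`, `rfl`).
* **`traceShiftedHom_comp_nuClass`** (LINEARITY): `Tr′_{q+1}(y · ν_q(K)) = Tr′_q(y) · κ_q` with
  `κ_q = δ_{dlogScalarSES_q[0]}` the scalar class of `[-dlog c] ∧ –` (bricks `CocycleExtensionPostcomp` +
  `HomComplexSupertraceTriangle`).
* **`traceShiftedHom_twist`** (INVARIANCE under `- ⊗ M`): for `θ′ = shiftedHomMap (prolong c)` (the descended `- ⊗ M` on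
  shifted Homs) and every `y : Q K ⟶ Q(K ⊗ Ωⁱ)⟦i+2⟧`:
  `Tr′^{K ⊗ M}_i(θ′(y) · [Q λ•_i]) = Tr′^{K}_i(y)` — NO correction factor (`d_i = id`): bricks `HomComplexTwist(Trace)` +
  `DerivedDescentComp` + p3's `shiftedHomMap_comp_shift_map`.

## References

* R.-O. Buchweitz, H. Flenner, Compositio Math. 137 (2003), §4, Def. 4.1. [BuchweitzFlenner2003]
* M. F. Atiyah, Trans. AMS 85 (1957), Prop. 10–12. [Atiyah1957]
-/

noncomputable section

set_option backward.isDefEq.respectTransparency false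

open CategoryTheory CategoryTheory.Limits AlgebraicGeometry DerivedCategory

namespace Summit.Ventures.HSemireg

namespace HomComplex

open Literature.AlgebraicGeometry.Modules Literature.AlgebraicGeometry.Motives Literature.AlgebraicGeometry.HodgeTheory
  CocycleTwist

universe w u

variable {S : Type u} [CommRing S] (X : Over (Spec (CommRingCat.of S))) [HasDerivedCategory.{w} X.left.Modules]
  (K : CochainComplex X.left.Modules ℤ) (a b : ℤ) [K.IsStrictlyGE a] [K.IsStrictlyLE b]
  (hK : ∀ p, IsFiniteLocallyFree (K.X p))

/-! ### `Tr′_q : z ↦ [Q unit] · Φ_K(z) · [Q Tr•_q]` -/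

/-- **The traced shifted Hom** `Tr′_q(z) = [Q unit] · Φ_K(z) · [Q Tr•_q]` for `z : Q K ⟶ Q(K ⊗ Ω^q)⟦q+2⟧` — the
pipeline of `HomComplex.sigmaC` with the argument `x · ι• · At(K•)^q` replaced by a variable.
[cite: BuchweitzFlenner2003, Def. 4.1] -/
def traceShiftedHomFun (q : ℕ) (z : ShiftedHom (Q.obj K) (Q.obj (twistHodgeComplex X q K)) ((q : ℤ) + 2)) :
    ShiftedHom (Q.obj ((HomologicalComplex.single X.left.Modules (ComplexShape.up ℤ) 0).obj (unitModule X.left)))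
      (Q.obj ((HomologicalComplex.single X.left.Modules (ComplexShape.up ℤ) 0).obj (hodgeSheaf X q))) ((q + 2 : ℕ) : ℤ) :=
  ((ShiftedHom.mk₀ (0 : ℤ) rfl (unitQ X K a b)).comp (shiftedHomMap (homFunctor X.left K) (homFunctor_isInvertedBy X K a b hK) z)
    (add_zero _)).comp (ShiftedHom.mk₀ (0 : ℤ) rfl (Q.map (supertraceH X K hK q))) (by omega)

/-- `Tr′_q` is additive. [folklore] -/
def traceShiftedHom (q : ℕ) :
    ShiftedHom (Q.obj K) (Q.obj (twistHodgeComplex X q K)) ((q : ℤ) + 2) →+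
      ShiftedHom (Q.obj ((HomologicalComplex.single X.left.Modules (ComplexShape.up ℤ) 0).obj (unitModule X.left)))
        (Q.obj ((HomologicalComplex.single X.left.Modules (ComplexShape.up ℤ) 0).obj (hodgeSheaf X q))) ((q + 2 : ℕ) : ℤ) where
  toFun := traceShiftedHomFun X K a b hK q
  map_zero' := by
    simp only [traceShiftedHomFun]
    rw [show shiftedHomMap (homFunctor X.left K) (homFunctor_isInvertedBy X K a b hK)
        (0 : ShiftedHom (Q.obj K) (Q.obj (twistHodgeComplex X q K)) ((q : ℤ) + 2)) = 0 from by
      have h := shiftedHomMap_add (homFunctor X.left K) (homFunctor_isInvertedBy X K a b hK)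
        (0 : ShiftedHom (Q.obj K) (Q.obj (twistHodgeComplex X q K)) ((q : ℤ) + 2)) 0
      rw [add_zero] at h
      exact left_eq_add.mp h,
      ShiftedHom.comp_zero, ShiftedHom.zero_comp]
  map_add' z z' := by
    simp only [traceShiftedHomFun]
    rw [shiftedHomMap_add, ShiftedHom.comp_add, ShiftedHom.add_comp]

/-- Unfolding `Tr′_q`. [folklore] -/
theorem traceShiftedHom_apply (q : ℕ) (z : ShiftedHom (Q.obj K) (Q.obj (twistHodgeComplex X q K)) ((q : ℤ) + 2)) :
    traceShiftedHom X K a b hK q z =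
      ((ShiftedHom.mk₀ (0 : ℤ) rfl (unitQ X K a b)).comp
        (shiftedHomMap (homFunctor X.left K) (homFunctor_isInvertedBy X K a b hK) z) (add_zero _)).comp
        (ShiftedHom.mk₀ (0 : ℤ) rfl (Q.map (supertraceH X K hK q))) (by omega) :=
  rfl

/-- **`σ_q = Tr′_q ∘ (x ↦ x · ι• · At(K•)^q)`** (definitional). [cite: BuchweitzFlenner2003, Def. 4.1] -/
theorem sigmaC_eq_traceShiftedHom (q : ℕ) (x : ShiftedHom (Q.obj K) (Q.obj K) (2 : ℤ)) :
    sigmaC X K a b hK q x = traceShiftedHom X K a b hK q (extMulAtiyahPower X K q x) :=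
  rfl

/-! ### Linearity over `ν = 1 ⊗ [dlog c]` -/

section Linearity

variable (c : UnitCocycle X.left)

/-- **The scalar class `κ_q = [(-dlog c) ∧ –] ∈ Hom(Q Ω^q[0], Q Ω^{q+1}[0]⟦1⟧)`**: the connecting morphism of the scalar
extension `0 → Ωʲ⁺¹ → R_j → Ωʲ → 0` placed in degree `0`. [cite: Atiyah1957, Prop. 12] -/
def dlogScalarClass (q : ℕ) :
    ShiftedHom (Q.obj ((HomologicalComplex.single X.left.Modules (ComplexShape.up ℤ) 0).obj (hodgeSheaf X q)))
      (Q.obj ((HomologicalComplex.single X.left.Modules (ComplexShape.up ℤ) 0).obj (hodgeSheaf X (q + 1)))) (1 : ℤ) :=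
  triangleOfSESδ ((dlogScalarSES_shortExact c q).map_of_exact
    (HomologicalComplex.single X.left.Modules (ComplexShape.up ℤ) 0))

/-- The cup with the scalar class, `w ↦ w · κ_q`, as an additive map `W_q → W_{q+1}` (the mixing step `K_q`).
[folklore] -/
def compDlogScalarClass (q : ℕ) :
    ShiftedHom (Q.obj ((HomologicalComplex.single X.left.Modules (ComplexShape.up ℤ) 0).obj (unitModule X.left)))
        (Q.obj ((HomologicalComplex.single X.left.Modules (ComplexShape.up ℤ) 0).obj (hodgeSheaf X q))) ((q + 2 : ℕ) : ℤ) →+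
      ShiftedHom (Q.obj ((HomologicalComplex.single X.left.Modules (ComplexShape.up ℤ) 0).obj (unitModule X.left)))
        (Q.obj ((HomologicalComplex.single X.left.Modules (ComplexShape.up ℤ) 0).obj (hodgeSheaf X (q + 1))))
        ((q + 1 + 2 : ℕ) : ℤ) :=
  AddMonoidHom.mk' (fun w => w.comp (dlogScalarClass X c q) (by omega)) fun _ _ => ShiftedHom.add_comp _ _ _ _

/-- Unfolding `compDlogScalarClass`. [folklore] -/
@[simp]
theorem compDlogScalarClass_apply (q : ℕ) (w) :
    compDlogScalarClass X c q w = w.comp (dlogScalarClass X c q) (by omega) := rfl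

/-- **`ν_q · [e_{q+1}] = [e_q] · δ_{K ⊗ R}`**: transport of `ν_q(K)` along the (identity) spelling isomorphisms
`twistHodgeIsoG` to the connecting morphism of `K ⊗ dlogScalarSES_q`. [folklore] -/
theorem nuClass_comp_mk₀_twistHodgeIsoG (q : ℕ) :
    ShiftedHom.comp (M := ℤ) (a := 1) (b := 0) (nuClass c q K)
        (ShiftedHom.mk₀ (0 : ℤ) rfl (Q.map (twistHodgeIsoG X K (q + 1)).hom)) (zero_add 1) =
      (ShiftedHom.mk₀ (0 : ℤ) rfl (Q.map (twistHodgeIsoG X K q).hom)).comp (M := ℤ) (a := 0) (b := 1)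
        (triangleOfSESδ (twistShortComplex_shortExact X.left (dlogScalarSES c q) K hK (dlogScalarSES_shortExact c q)))
        (add_zero 1) := by
  rw [ShiftedHom.comp_mk₀, ShiftedHom.mk₀_comp, triangleOfSESδ_twistShortComplex_dlogScalarSES c q K hK]
  change nuClass c q K ≫ (Q.map (𝟙 _))⟦(1 : ℤ)⟧' = Q.map (𝟙 _) ≫ nuClass c q K
  rw [CategoryTheory.Functor.map_id, CategoryTheory.Functor.map_id, CategoryTheory.Functor.map_id]
  erw [Category.comp_id, Category.id_comp]

/-- **Trace linearity in `ShiftedHom.comp` form**: `Φ_K(δ_{K ⊗ R}) · [Q Tr•_{q+1}] = [Q Tr•_q] · κ_q`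
(t-7/gs-g4's `shiftedHomMap_twistδ_comp_supertrace`). [cite: BuchweitzFlenner2003, §4] -/
theorem shiftedHomMap_twistδ_comp_mk₀_supertrace (q : ℕ) :
    ShiftedHom.comp (M := ℤ) (a := 1) (b := 0)
        (shiftedHomMap (homFunctor X.left K) (homFunctor_isInvertedBy X K a b hK)
          (triangleOfSESδ (twistShortComplex_shortExact X.left (dlogScalarSES c q) K hK (dlogScalarSES_shortExact c q)) :
            ShiftedHom (Q.obj (twistG X.left (hodgeSheaf X q) K)) (Q.obj (twistG X.left (hodgeSheaf X (q + 1)) K)) (1 : ℤ)))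
        (ShiftedHom.mk₀ (0 : ℤ) rfl (Q.map (supertrace X.left (hodgeSheaf X (q + 1)) K hK))) (zero_add 1) =
      (ShiftedHom.mk₀ (0 : ℤ) rfl (Q.map (supertrace X.left (hodgeSheaf X q) K hK))).comp (dlogScalarClass X c q)
        (add_zero 1) := by
  rw [ShiftedHom.comp_mk₀, ShiftedHom.mk₀_comp]
  exact shiftedHomMap_twistδ_comp_supertrace X.left (dlogScalarSES c q) K hK (homFunctor_isInvertedBy X K a b hK)
    (dlogScalarSES_shortExact c q)

/-- `[Q(f ≫ g)] = [Q f] · [Q g]` in degree `0`. [folklore] -/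
theorem mk₀_map_comp {A B C : CochainComplex X.left.Modules ℤ} (f : A ⟶ B) (g : B ⟶ C) :
    ShiftedHom.mk₀ (0 : ℤ) rfl (Q.map (f ≫ g)) =
      (ShiftedHom.mk₀ (0 : ℤ) rfl (Q.map f)).comp (ShiftedHom.mk₀ (0 : ℤ) rfl (Q.map g)) (add_zero 0) := by
  rw [Functor.map_comp, ShiftedHom.mk₀_comp_mk₀]

/-- **LINEARITY of the traced shifted Homs over `ν`**: `Tr′_{q+1}(y · ν_q(K)) = Tr′_q(y) · κ_q`.
[cite: BuchweitzFlenner2003, §4] -/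
theorem traceShiftedHom_comp_nuClass (q : ℕ) (y : ShiftedHom (Q.obj K) (Q.obj (twistHodgeComplex X q K)) ((q : ℤ) + 2)) :
    traceShiftedHom X K a b hK (q + 1) (y.comp (nuClass c q K)
        (show (1 : ℤ) + ((q : ℤ) + 2) = ((q + 1 : ℕ) : ℤ) + 2 by omega)) =
      compDlogScalarClass X c q (traceShiftedHom X K a b hK q y) := by
  rw [compDlogScalarClass_apply, traceShiftedHom_apply, traceShiftedHom_apply, shiftedHomMap_comp', supertraceH,
    supertraceH, mk₀_map_comp, mk₀_map_comp]
  set U := ShiftedHom.mk₀ (0 : ℤ) rfl (unitQ X K a b) with hU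
  set Y := shiftedHomMap (homFunctor X.left K) (homFunctor_isInvertedBy X K a b hK) y with hY
  set N := shiftedHomMap (homFunctor X.left K) (homFunctor_isInvertedBy X K a b hK)
    (nuClass c q K : ShiftedHom (Q.obj (twistHodgeComplex X q K)) (Q.obj (twistHodgeComplex X (q + 1) K)) (1 : ℤ)) with hN
  set M := ShiftedHom.mk₀ (0 : ℤ) rfl (Q.map ((homFunctor X.left K).map (twistHodgeIsoG X K (q + 1)).hom)) with hM
  set T := ShiftedHom.mk₀ (0 : ℤ) rfl (Q.map (supertrace X.left (hodgeSheaf X (q + 1)) K hK)) with hT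
  set E := ShiftedHom.mk₀ (0 : ℤ) rfl (Q.map ((homFunctor X.left K).map (twistHodgeIsoG X K q).hom)) with hE
  set T₀ := ShiftedHom.mk₀ (0 : ℤ) rfl (Q.map (supertrace X.left (hodgeSheaf X q) K hK)) with hT₀
  set κ := dlogScalarClass X c q with hκ
  -- left-hand side: `(U·(Y·N))·(M·T) = U·(Y·((N·M)·T))`
  rw [ShiftedHom.comp_assoc U (Y.comp N (show (1 : ℤ) + ((q : ℤ) + 2) = ((q + 1 : ℕ) : ℤ) + 2 by omega))
      (M.comp T (add_zero 0)) (add_zero _) (zero_add _)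
      (show (0 : ℤ) + (((q + 1 : ℕ) : ℤ) + 2) + 0 = ((q + 1 + 2 : ℕ) : ℤ) by omega),
    ShiftedHom.comp_assoc Y N (M.comp T (add_zero 0)) (show (1 : ℤ) + ((q : ℤ) + 2) = ((q + 1 : ℕ) : ℤ) + 2 by omega)
      (zero_add 1) (show (0 : ℤ) + 1 + ((q : ℤ) + 2) = ((q + 1 : ℕ) : ℤ) + 2 by omega),
    ← ShiftedHom.comp_assoc N M T (zero_add 1) (add_zero 0) (show (0 : ℤ) + 0 + 1 = 1 by omega)]
  -- `N·M = Φ(ν·[e]) = Φ([e]·δ) = E·Φ(δ)`, then trace linearity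
  rw [hN, hM, ← shiftedHomMap_comp_mk₀, nuClass_comp_mk₀_twistHodgeIsoG X K hK c q, shiftedHomMap_mk₀_comp, ← hE, hT,
    ShiftedHom.comp_assoc E _ _ (add_zero 1) (zero_add 1) (show (0 : ℤ) + 1 + 0 = 1 by omega),
    shiftedHomMap_twistδ_comp_mk₀_supertrace X K a b hK c q, ← hT₀, ← hκ]
  -- right-hand side: `((U·Y)·(E·T₀))·κ = U·(Y·(E·(T₀·κ)))`
  rw [ShiftedHom.comp_assoc (U.comp Y (add_zero _)) (E.comp T₀ (add_zero 0)) κ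
      (show (0 : ℤ) + ((q : ℤ) + 2) = ((q + 2 : ℕ) : ℤ) by omega) (add_zero 1)
      (show (1 : ℤ) + 0 + ((q : ℤ) + 2) = ((q + 1 + 2 : ℕ) : ℤ) by omega),
    ShiftedHom.comp_assoc U Y ((E.comp T₀ (add_zero 0)).comp κ (add_zero 1)) (add_zero _)
      (show (1 : ℤ) + ((q : ℤ) + 2) = ((q + 1 : ℕ) : ℤ) + 2 by omega)
      (show (1 : ℤ) + ((q : ℤ) + 2) + 0 = ((q + 1 + 2 : ℕ) : ℤ) by omega),
    ShiftedHom.comp_assoc E T₀ κ (add_zero 0) (add_zero 1) (show (1 : ℤ) + 0 + 0 = 1 by omega)]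

end Linearity

/-! ### Invariance under `- ⊗ M` -/

section Twist

variable (c : UnitCocycle X.left)

omit [HasDerivedCategory X.left.Modules] [K.IsStrictlyGE a] [K.IsStrictlyLE b] in
/-- `- ⊗ M` termwise preserves quasi-isomorphisms (an equivalence is exact). [folklore] -/
theorem quasiIso_prolong_map {L L' : CochainComplex X.left.Modules ℤ} (f : L ⟶ L') (hf : QuasiIso f) :
    QuasiIso ((prolong c).map f) := by
  haveI := hf
  infer_instance

/-- `(- ⊗ M) ⋙ Q` inverts quasi-isomorphisms. [folklore] -/
theorem prolong_isInvertedBy :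
    (HomologicalComplex.quasiIso X.left.Modules (ComplexShape.up ℤ)).IsInvertedBy (prolong c ⋙ DerivedCategory.Q) :=
  isInvertedBy_of_map_quasiIso fun _ _ f hf => quasiIso_prolong_map X c f hf

include a b hK in
/-- `((- ⊗ M) ⋙ 𝓗om•(K ⊗ M, –)) ⋙ Q` inverts quasi-isomorphisms for `K` strictly perfect. [folklore] -/
theorem prolong_homFunctor_isInvertedBy :
    (HomologicalComplex.quasiIso X.left.Modules (ComplexShape.up ℤ)).IsInvertedBy
      ((prolong c ⋙ homFunctor X.left ((prolong c).obj K)) ⋙ DerivedCategory.Q) :=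
  isInvertedBy_of_map_quasiIso (Φ := prolong c ⋙ homFunctor X.left ((prolong c).obj K)) fun _ _ f hf =>
    homFunctor_map_quasiIso X ((prolong c).obj K) a b (isFiniteLocallyFree_cocycleTwistComplex_X c hK) _
      (quasiIso_prolong_map X c f hf)

/-- **`θ′ = (- ⊗ M)_*` on shifted Homs** (`shiftedHomMap (prolong c)`): the CONSTRUCTED transport
`Hom_D(Q K, Q L⟦n⟧) → Hom_D(Q(K ⊗ M), Q(L ⊗ M)⟦n⟧)`. [folklore] -/
abbrev thetaPrime {A B : CochainComplex X.left.Modules ℤ} {n : ℤ} (y : ShiftedHom (Q.obj A) (Q.obj B) n) :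
    ShiftedHom (Q.obj ((prolong c).obj A)) (Q.obj ((prolong c).obj B)) n :=
  shiftedHomMap (prolong c) (prolong_isInvertedBy X c) y

/-- **`λ•_j` with `(prolong c).obj` ends** (g21's `lamC` RETYPED, t-7's `twistHodgeComplexMap` device: under `𝓗om•` every
composition must be SYNTACTICALLY well-typed, see the KERNEL NOTE of `HomComplexSigmaConj`). [folklore] -/
def lamP (j : ℕ) : (prolong c).obj (twistHodgeComplex X j K) ⟶ twistHodgeComplex X j ((prolong c).obj K) := lamC c j K

omit [HasDerivedCategory X.left.Modules] [K.IsStrictlyGE a] [K.IsStrictlyLE b] in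
/-- `lamP` is `lamC` (definitionally; complexes level). [folklore] -/
theorem lamP_eq_lamC (j : ℕ) : lamP X K c j = lamC c j K := rfl

omit [HasDerivedCategory X.left.Modules] [K.IsStrictlyGE a] [K.IsStrictlyLE b] in
/-- Components of `lamP`. [folklore] -/
@[simp]
theorem lamP_f (j : ℕ) (i : ℤ) : (lamP X K c j).f i = dualHomTwist c (K.X i) (hodgeSheaf X j) := rfl

omit [HasDerivedCategory X.left.Modules] [K.IsStrictlyGE a] [K.IsStrictlyLE b] in
/-- `(- ⊗ M)(e_K) ≫ λ•_G = λ• ≫ e_{K ⊗ M}` for the spelling isomorphisms `e = twistHodgeIsoG` (all components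
`λ`). [folklore] -/
theorem prolong_map_twistHodgeIsoG_comp_lamG (j : ℕ) :
    (prolong c).map (twistHodgeIsoG X K j).hom ≫ lamG c (hodgeSheaf X j) K =
      lamP X K c j ≫ (twistHodgeIsoG X ((prolong c).obj K) j).hom := by
  refine HomologicalComplex.hom_ext _ _ fun p => ?_
  rw [HomologicalComplex.comp_f, HomologicalComplex.comp_f, Functor.mapHomologicalComplex_map_f, lamG_f, lamP_f]
  change CocycleTwist.twistMap c (𝟙 _) ≫ _ = _ ≫ 𝟙 _
  rw [CocycleTwist.twistMap_id, Category.id_comp, Category.comp_id]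

omit [HasDerivedCategory X.left.Modules] [K.IsStrictlyGE a] [K.IsStrictlyLE b] in
/-- `𝓗om•(K ⊗ M, λ•) ≫ 𝓗om•(K ⊗ M, e_{K ⊗ M}) = 𝓗om•(K ⊗ M, (- ⊗ M)(e_K)) ≫ 𝓗om•(K ⊗ M, λ•_G)`. [folklore] -/
theorem homFunctor_map_lamP_comp_map_twistHodgeIsoG (j : ℕ) :
    (homFunctor X.left ((prolong c).obj K)).map (lamP X K c j) ≫
        (homFunctor X.left ((prolong c).obj K)).map (twistHodgeIsoG X ((prolong c).obj K) j).hom =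
      (homFunctor X.left ((prolong c).obj K)).map ((prolong c).map (twistHodgeIsoG X K j).hom) ≫
        (homFunctor X.left ((prolong c).obj K)).map (lamG c (hodgeSheaf X j) K) := by
  rw [← Functor.map_comp, ← Functor.map_comp, prolong_map_twistHodgeIsoG_comp_lamG]

omit [HasDerivedCategory X.left.Modules] [K.IsStrictlyGE a] [K.IsStrictlyLE b] in
/-- Naturality of the twist map along `(- ⊗ M)(e_K)`, in the `(homFunctor _).map` spelling. [folklore] -/
theorem twistApp_comp_homFunctor_map_prolong_map_twistHodgeIsoG (j : ℕ) :
    twistApp c K (twistHodgeComplex X j K) ≫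
        (homFunctor X.left ((prolong c).obj K)).map ((prolong c).map (twistHodgeIsoG X K j).hom) =
      (homFunctor X.left K).map (twistHodgeIsoG X K j).hom ≫ twistApp c K (twistG X.left (hodgeSheaf X j) K) :=
  (map_comp_twistApp c K (twistHodgeIsoG X K j).hom).symm

omit [HasDerivedCategory X.left.Modules] [K.IsStrictlyGE a] [K.IsStrictlyLE b] in
/-- The supertrace compatibility in the `(homFunctor _).map` spelling. [folklore] -/
theorem twistApp_comp_homFunctor_map_lamG_comp_supertrace (j : ℕ) :
    twistApp c K (twistG X.left (hodgeSheaf X j) K) ≫ (homFunctor X.left ((prolong c).obj K)).map (lamG c (hodgeSheaf X j) K) ≫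
        supertrace X.left (hodgeSheaf X j) ((prolong c).obj K) (isFiniteLocallyFree_cocycleTwistComplex_X c hK) =
      supertrace X.left (hodgeSheaf X j) K hK :=
  twistApp_comp_map_lamG_comp_supertrace c (hodgeSheaf X j) K hK

omit [HasDerivedCategory X.left.Modules] [K.IsStrictlyGE a] [K.IsStrictlyLE b] in
/-- **The twist preserves the `σ`-pipeline's supertrace**:
`twistApp ≫ 𝓗om•(K ⊗ M, λ•_j) ≫ supertraceH(K ⊗ M) = supertraceH(K)`. [cite: BuchweitzFlenner2003, §4] -/
theorem twistApp_comp_map_lamP_comp_supertraceH (j : ℕ) :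
    twistApp c K (twistHodgeComplex X j K) ≫ (homFunctor X.left ((prolong c).obj K)).map (lamP X K c j) ≫
        supertraceH X ((prolong c).obj K) (isFiniteLocallyFree_cocycleTwistComplex_X c hK) j =
      supertraceH X K hK j := by
  unfold supertraceH
  rw [← Category.assoc ((homFunctor X.left ((prolong c).obj K)).map (lamP X K c j)),
    homFunctor_map_lamP_comp_map_twistHodgeIsoG X K c j, Category.assoc, ← Category.assoc (twistApp c K _),
    twistApp_comp_homFunctor_map_prolong_map_twistHodgeIsoG X K c j, Category.assoc,
    twistApp_comp_homFunctor_map_lamG_comp_supertrace X K hK c j]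

/-- **The twist preserves the unit of the `σ`-pipeline**: `[Q(unit(K ⊗ M))] = [Q(unit K)] · [Q(twistApp)]`. [folklore] -/
theorem mk₀_unitQ_prolong :
    ShiftedHom.mk₀ (0 : ℤ) rfl (unitQ X ((prolong c).obj K) a b) =
      (ShiftedHom.mk₀ (0 : ℤ) rfl (unitQ X K a b)).comp (ShiftedHom.mk₀ (0 : ℤ) rfl (Q.map ((twistNatTrans c K).app K)))
        (add_zero 0) := by
  rw [ShiftedHom.mk₀_comp_mk₀, unitQ, unitQ, twistNatTrans_app, ← Functor.map_comp, unit_twist]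

/-- **Naturality of `Φ` along the twist**, `ShiftedHom.comp` form: `Φ_K(y) · [Q twistApp] = [Q twistApp] · Φ₂(y)` with
`Φ₂ = shiftedHomMap ((- ⊗ M) ⋙ 𝓗om•(K ⊗ M, –))`. [folklore] -/
theorem shiftedHomMap_comp_mk₀_twistNatTrans {L : CochainComplex X.left.Modules ℤ} {n : ℤ}
    (y : ShiftedHom (Q.obj K) (Q.obj L) n) :
    (shiftedHomMap (homFunctor X.left K) (homFunctor_isInvertedBy X K a b hK) y).comp
        (ShiftedHom.mk₀ (0 : ℤ) rfl (Q.map ((twistNatTrans c K).app L))) (zero_add n) =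
      (ShiftedHom.mk₀ (0 : ℤ) rfl (Q.map ((twistNatTrans c K).app K))).comp
        (shiftedHomMap (prolong c ⋙ homFunctor X.left ((prolong c).obj K)) (prolong_homFunctor_isInvertedBy X K a b hK c) y)
        (add_zero n) := by
  rw [ShiftedHom.comp_mk₀, ShiftedHom.mk₀_comp]
  exact shiftedHomMap_comp_shift_map (homFunctor_isInvertedBy X K a b hK) (prolong_homFunctor_isInvertedBy X K a b hK c)
    (twistNatTrans c K) y

/-- **INVARIANCE of the traced shifted Homs under `- ⊗ M`**: `Tr′^{K ⊗ M}_i(θ′(y) · [Q λ•_i]) = Tr′^K_i(y)` — no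
correction factor (`d_i = id`). [cite: BuchweitzFlenner2003, §4] -/
theorem traceShiftedHom_twist (i : ℕ) (y : ShiftedHom (Q.obj K) (Q.obj (twistHodgeComplex X i K)) ((i : ℤ) + 2)) :
    traceShiftedHom X ((prolong c).obj K) a b (isFiniteLocallyFree_cocycleTwistComplex_X c hK) i
        ((thetaPrime X c y).comp (ShiftedHom.mk₀ (0 : ℤ) rfl (Q.map (lamP X K c i))) (zero_add _)) =
      traceShiftedHom X K a b hK i y := by
  rw [traceShiftedHom_apply, traceShiftedHom_apply, shiftedHomMap_comp_mk₀, thetaPrime,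
    ← shiftedHomMap_functor_comp (prolong c) (homFunctor X.left ((prolong c).obj K)) (prolong_isInvertedBy X c)
      (homFunctor_isInvertedBy X ((prolong c).obj K) a b (isFiniteLocallyFree_cocycleTwistComplex_X c hK))
      (prolong_homFunctor_isInvertedBy X K a b hK c),
    mk₀_unitQ_prolong X K a b c]
  set UK := ShiftedHom.mk₀ (0 : ℤ) rfl (unitQ X K a b) with hUK
  set τK := ShiftedHom.mk₀ (0 : ℤ) rfl (Q.map ((twistNatTrans c K).app K)) with hτK
  set Y₂ := shiftedHomMap (prolong c ⋙ homFunctor X.left ((prolong c).obj K)) (prolong_homFunctor_isInvertedBy X K a b hK c) y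
    with hY₂
  set Y := shiftedHomMap (homFunctor X.left K) (homFunctor_isInvertedBy X K a b hK) y with hY
  set L := ShiftedHom.mk₀ (0 : ℤ) rfl (Q.map ((homFunctor X.left ((prolong c).obj K)).map (lamP X K c i))) with hL
  set TF := ShiftedHom.mk₀ (0 : ℤ) rfl
    (Q.map (supertraceH X ((prolong c).obj K) (isFiniteLocallyFree_cocycleTwistComplex_X c hK) i)) with hTF
  set TK := ShiftedHom.mk₀ (0 : ℤ) rfl (Q.map (supertraceH X K hK i)) with hTK
  -- `((UK·τK)·(Y₂·L))·TF = (UK·((Y·[τ'])·L))·TF`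
  rw [ShiftedHom.comp_assoc UK τK (Y₂.comp L (zero_add _)) (add_zero 0) (add_zero _)
      (show ((i : ℤ) + 2) + 0 + 0 = (i : ℤ) + 2 by omega),
    ← ShiftedHom.comp_assoc τK Y₂ L (add_zero _) (zero_add _) (show (0 : ℤ) + ((i : ℤ) + 2) + 0 = (i : ℤ) + 2 by omega),
    hτK, hY₂, ← shiftedHomMap_comp_mk₀_twistNatTrans X K a b hK c y, ← hY,
    ShiftedHom.comp_assoc Y _ L (zero_add _) (add_zero 0) (show (0 : ℤ) + 0 + ((i : ℤ) + 2) = (i : ℤ) + 2 by omega),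
    ShiftedHom.comp_assoc UK (Y.comp _ (zero_add _)) TF (add_zero _)
      (show (0 : ℤ) + ((i : ℤ) + 2) = ((i + 2 : ℕ) : ℤ) by omega)
      (show (0 : ℤ) + ((i : ℤ) + 2) + 0 = ((i + 2 : ℕ) : ℤ) by omega)]
  set τ' := ShiftedHom.mk₀ (0 : ℤ) rfl (Q.map ((twistNatTrans c K).app (twistHodgeComplex X i K))) with hτ'
  rw [ShiftedHom.comp_assoc Y (τ'.comp L (add_zero 0)) TF (zero_add _) (add_zero 0)
      (show (0 : ℤ) + 0 + ((i : ℤ) + 2) = ((i + 2 : ℕ) : ℤ) by omega),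
    ShiftedHom.comp_assoc τ' L TF (add_zero 0) (add_zero 0) (show (0 : ℤ) + 0 + 0 = 0 by omega),
    hL, hTF, ← mk₀_map_comp, hτ', twistNatTrans_app, ← mk₀_map_comp, twistApp_comp_map_lamP_comp_supertraceH X K hK c i,
    ← hTK,
    ShiftedHom.comp_assoc UK Y TK (add_zero _) (show (0 : ℤ) + ((i : ℤ) + 2) = ((i + 2 : ℕ) : ℤ) by omega)
      (show (0 : ℤ) + ((i : ℤ) + 2) + 0 = ((i + 2 : ℕ) : ℤ) by omega)]

end Twist

end HomComplex

end Summit.Ventures.HSemireg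

end
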